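import Summits.AtomisticToContinuum.FouriersLaw.Theorems.EmbeddedDrudeMourreGreenKuboContinuationOrthonormalPolySeqExists
import Summits.AtomisticToContinuum.FouriersLaw.Theorems.EmbeddedDrudeMourreGreenKuboContinuationMnRecurrence
import Summits.AtomisticToContinuum.FouriersLaw.Theorems.EmbeddedDrudeMourreGreenKuboContinuationMnTuran
import Summits.AtomisticToContinuum.FouriersLaw.Theorems.EmbeddedDrudeMourreGreenKuboContinuationMnLocality
import Summits.AtomisticToContinuum.FouriersLaw.Theorems.EmbeddedDrudeMourreGreenKuboContinuationMnChebyshevMoments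
import Summits.AtomisticToContinuum.FouriersLaw.Theorems.EmbeddedDrudeMourreGreenKuboContinuationMnTestFunctions
import Summits.AtomisticToContinuum.FouriersLaw.Theorems.EmbeddedDrudeMourreGreenKuboContinuationMnIdentification
import Literature.Analysis.Approximation.MateNevaiBoundedVariation
import HarnessLib

/-!
# The Máté–Nevai bounded-variation theorem (even measures on a band) — stub S3 of line
# `FilterInvariance`, crux `EmbeddedDrudeMourre.GreenKuboContinuation` (stmt-AtomisticToContinuum-12597)

This file PROVES stub S3 `stub_mateNevaiBoundedVariation` of the line (registered signature; it is
`rfl`-identical to the Literature named fact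
`Literature.Analysis.Approximation.MateNevaiBoundedVariationEven`, which is thereby DISCHARGED:
`mateNevaiBoundedVariationEven_holds`).

**Theorem** (Máté–Nevai 1983 = Van Assche LNM 1265 Thm 2.27, case `b_n = 0`; Dombrowski–Nevai 1986
Thm 1). Let `τ` be a finite positive measure on `ℝ`, even and carried by `[-W, W]`, with orthonormal
polynomials `p_n` (`deg p_n = n`, `k_n > 0`). If `a_{n+1} = k_n / k_{n+1} → W/2` and
`Σ |a_{n+2} - a_{n+1}| < ∞`, then `τ|_{(-W,W)} = g dω` with `g` continuous and strictly positive on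
`(-W, W)`.

**Proof** (elementary and self-contained, assembled from six landed pieces of this line). On the unit
band (`mateNevai_unitBand`): evenness kills the diagonal Jacobi coefficients and gives the recurrence
`x p_n = a_{n+1} p_{n+1} + a_n p_{n-1}` (`stub_mnRecurrence`, p123402). The Turán quadratic forms
`S_n(x) = p_{n+1}² - (x/a_{n+1}) p_{n+1} p_n + p_n²` converge locally uniformly on `(-1, 1)` to a continuous
positive `S` under bounded variation (`stub_mnTuran`, p123769; estimates in
`Literature/Analysis/Approximation/TuranFormEstimates.lean`, p123646). Nevai's locality from `a_n → 1/2`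
alone: `∫ T_m S_n dτ → 1, 0, -1/2, 0, …` (`stub_mnLocality`, p123543), and these are
`(2/π) ∫_{-1}^{1} T_m √(1-x²) dx` (`stub_mnChebyshevMoments`, p123251). With the `L¹(τ)` bound
`∫ |S_n| dτ ≤ 2 + 1/a_{n+1}` (`integral_abs_turan_le`, here) and Weierstrass,
`∫ f S dτ = (2/π) ∫ f √(1-x²) dx` for continuous `f` compactly supported in `(-1, 1)`
(`stub_mnTestFunctions`, p123434); dividing the test functions by `S` and the Riesz identification on the
open band (`stub_mnIdentification`, p123549) give `τ|_{(-1,1)} = (2/π)√(1-x²)/S(x) dx`. The general band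
follows by the affine transport `x = ω / W` (tree:
`Literature.Analysis.Approximation.restrict_Ioo_eq_withDensity_of_map_inv_mul`).
-/

noncomputable section

namespace Summit.AtomisticToContinuum.FouriersLaw.Theorems.GreenKuboContinuation.BandLimitedKrylov

open Filter Topology MeasureTheory Set Polynomial

/-! ## S3 on the unit band: composition of the six pieces -/

/-- Every polynomial is integrable for a finite measure carried by `[-1, 1]` (tree `integrable_eval`,
band `W = 1`). -/
theorem integrable_eval_unit {τ : Measure ℝ} [IsFiniteMeasure τ] (hsupp : τ (Set.Icc (-1 : ℝ) 1)ᶜ = 0)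
    (f : ℝ[X]) : Integrable (fun ω => f.eval ω) τ :=
  integrable_eval (W := 1) hsupp f

/-- The `L¹(τ)` bound of the Turán forms: `∫ |S_n| dτ ≤ 2 + 1/A_n` for an orthonormal sequence and a
measure carried by `[-1, 1]` (`2|x p_{n+1} p_n| ≤ p_{n+1}² + x² p_n²`, `x² ≤ 1` a.e.). -/
theorem integral_abs_turan_le {τ : Measure ℝ} [IsFiniteMeasure τ]
    (hsupp : τ (Set.Icc (-1 : ℝ) 1)ᶜ = 0) (p : ℕ → ℝ[X])
    (horth : ∀ m n, ∫ ω, (p m).eval ω * (p n).eval ω ∂τ = if m = n then 1 else 0)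
    (A : ℕ → ℝ) (hA : ∀ n, 0 < A n) (n : ℕ) :
    ∫ ω, |((p (n + 1)).eval ω) ^ 2 - ω / A n * (p (n + 1)).eval ω * (p n).eval ω
        + ((p n).eval ω) ^ 2| ∂τ ≤ 2 + (A n)⁻¹ := by
  have hint : ∀ f : ℝ[X], Integrable (fun ω => f.eval ω) τ := integrable_eval_unit hsupp
  have hae : ∀ᵐ ω ∂τ, ω ∈ Set.Icc (-1 : ℝ) 1 := by
    filter_upwards [mem_ae_iff.2 hsupp] with ω hω using hω
  set u : ℝ → ℝ := fun ω => (p (n + 1)).eval ω with hu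
  set v : ℝ → ℝ := fun ω => (p n).eval ω with hv
  have hu_int : Integrable (fun ω => u ω ^ 2) τ := by
    have := hint ((p (n + 1)) ^ 2); simpa [hu, eval_pow] using this
  have hv_int : Integrable (fun ω => v ω ^ 2) τ := by
    have := hint ((p n) ^ 2); simpa [hv, eval_pow] using this
  have hxv_int : Integrable (fun ω => ω ^ 2 * v ω ^ 2) τ := by
    have := hint (X ^ 2 * (p n) ^ 2); simpa [hv, eval_pow, eval_mul] using this
  have hu1 : ∫ ω, u ω ^ 2 ∂τ = 1 := by
    have := horth (n + 1) (n + 1); simp only [if_true] at this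
    simpa [hu, pow_two] using this
  have hv1 : ∫ ω, v ω ^ 2 ∂τ = 1 := by
    have := horth n n; simp only [if_true] at this
    simpa [hv, pow_two] using this
  have hxv1 : ∫ ω, ω ^ 2 * v ω ^ 2 ∂τ ≤ 1 := by
    calc ∫ ω, ω ^ 2 * v ω ^ 2 ∂τ ≤ ∫ ω, v ω ^ 2 ∂τ := by
          refine integral_mono_ae hxv_int hv_int ?_
          filter_upwards [hae] with ω hω
          have hω2 : ω ^ 2 ≤ 1 := by
            have h1 : -1 ≤ ω := hω.1
            have h2 : ω ≤ 1 := hω.2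
            nlinarith
          have hv0 : 0 ≤ v ω ^ 2 := sq_nonneg _
          nlinarith
      _ = 1 := hv1
  have hAi : 0 ≤ (A n)⁻¹ := inv_nonneg.2 (hA n).le
  -- pointwise bound
  have hpt : ∀ ω, |u ω ^ 2 - ω / A n * u ω * v ω + v ω ^ 2| ≤
      u ω ^ 2 + (A n)⁻¹ * ((u ω ^ 2 + ω ^ 2 * v ω ^ 2) / 2) + v ω ^ 2 := by
    intro ω
    have h3 : |u ω * (ω * v ω)| ≤ (u ω ^ 2 + ω ^ 2 * v ω ^ 2) / 2 := by
      rw [abs_le]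
      constructor <;> nlinarith [sq_nonneg (u ω - ω * v ω), sq_nonneg (u ω + ω * v ω)]
    have h2 : |ω / A n * u ω * v ω| ≤ (A n)⁻¹ * ((u ω ^ 2 + ω ^ 2 * v ω ^ 2) / 2) := by
      rw [show ω / A n * u ω * v ω = (A n)⁻¹ * (u ω * (ω * v ω)) by ring, abs_mul,
        abs_of_nonneg hAi]
      exact mul_le_mul_of_nonneg_left h3 hAi
    have h4 : |u ω ^ 2 - ω / A n * u ω * v ω + v ω ^ 2| ≤
        |u ω ^ 2| + |ω / A n * u ω * v ω| + |v ω ^ 2| := by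
      calc |u ω ^ 2 - ω / A n * u ω * v ω + v ω ^ 2|
          ≤ |u ω ^ 2 - ω / A n * u ω * v ω| + |v ω ^ 2| := abs_add_le _ _
        _ ≤ |u ω ^ 2| + |ω / A n * u ω * v ω| + |v ω ^ 2| := by
            gcongr; exact abs_sub _ _
    rw [abs_of_nonneg (sq_nonneg (u ω)), abs_of_nonneg (sq_nonneg (v ω))] at h4
    linarith
  have hmid_int : Integrable (fun ω => (A n)⁻¹ * ((u ω ^ 2 + ω ^ 2 * v ω ^ 2) / 2)) τ :=
    ((hu_int.add hxv_int).div_const 2).const_mul _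
  have hleft_int : Integrable (fun ω => u ω ^ 2 + (A n)⁻¹ * ((u ω ^ 2 + ω ^ 2 * v ω ^ 2) / 2)) τ :=
    hu_int.add hmid_int
  have hrhs_int : Integrable
      (fun ω => u ω ^ 2 + (A n)⁻¹ * ((u ω ^ 2 + ω ^ 2 * v ω ^ 2) / 2) + v ω ^ 2) τ :=
    hleft_int.add hv_int
  have e1 : ∫ ω, (u ω ^ 2 + (A n)⁻¹ * ((u ω ^ 2 + ω ^ 2 * v ω ^ 2) / 2) + v ω ^ 2) ∂τ
      = (∫ ω, (u ω ^ 2 + (A n)⁻¹ * ((u ω ^ 2 + ω ^ 2 * v ω ^ 2) / 2)) ∂τ) + ∫ ω, v ω ^ 2 ∂τ :=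
    integral_add hleft_int hv_int
  have e2 : ∫ ω, (u ω ^ 2 + (A n)⁻¹ * ((u ω ^ 2 + ω ^ 2 * v ω ^ 2) / 2)) ∂τ
      = (∫ ω, u ω ^ 2 ∂τ) + ∫ ω, (A n)⁻¹ * ((u ω ^ 2 + ω ^ 2 * v ω ^ 2) / 2) ∂τ :=
    integral_add hu_int hmid_int
  have e3 : ∫ ω, (A n)⁻¹ * ((u ω ^ 2 + ω ^ 2 * v ω ^ 2) / 2) ∂τ
      = (A n)⁻¹ * (((∫ ω, u ω ^ 2 ∂τ) + ∫ ω, ω ^ 2 * v ω ^ 2 ∂τ) / 2) := by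
    rw [integral_const_mul, integral_div, integral_add hu_int hxv_int]
  calc ∫ ω, |u ω ^ 2 - ω / A n * u ω * v ω + v ω ^ 2| ∂τ
      ≤ ∫ ω, (u ω ^ 2 + (A n)⁻¹ * ((u ω ^ 2 + ω ^ 2 * v ω ^ 2) / 2) + v ω ^ 2) ∂τ :=
        integral_mono_of_nonneg (Eventually.of_forall fun ω => abs_nonneg _) hrhs_int
          (Eventually.of_forall hpt)
    _ = (∫ ω, u ω ^ 2 ∂τ) + (A n)⁻¹ * (((∫ ω, u ω ^ 2 ∂τ) + ∫ ω, ω ^ 2 * v ω ^ 2 ∂τ) / 2)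
          + ∫ ω, v ω ^ 2 ∂τ := by rw [e1, e2, e3]
    _ ≤ 1 + (A n)⁻¹ * ((1 + 1) / 2) + 1 := by
        rw [hu1, hv1]; gcongr
    _ = 2 + (A n)⁻¹ := by ring

/-- **The Máté–Nevai bounded-variation theorem on the unit band** (even finite measure carried by
`[-1, 1]`): composition of the six pieces `stub_mn*`. [cite: VanAssche1987, Thm 2.27 (case b_n = 0)] -/
theorem mateNevai_unitBand (τ : Measure ℝ) [IsFiniteMeasure τ]
    (heven : τ.map (fun ω : ℝ => -ω) = τ) (hsupp : τ (Set.Icc (-1 : ℝ) 1)ᶜ = 0)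
    (p : ℕ → ℝ[X]) (hdeg : ∀ n, (p n).natDegree = n) (hlc : ∀ n, 0 < (p n).leadingCoeff)
    (horth : ∀ m n, ∫ ω, (p m).eval ω * (p n).eval ω ∂τ = if m = n then 1 else 0)
    (hlim : Tendsto (fun n => (p n).leadingCoeff / (p (n + 1)).leadingCoeff) atTop (𝓝 (1 / 2)))
    (hbv : Summable (fun n => |(p (n + 1)).leadingCoeff / (p (n + 2)).leadingCoeff -
      (p n).leadingCoeff / (p (n + 1)).leadingCoeff|)) :
    ∃ g : ℝ → ℝ, ContinuousOn g (Set.Ioo (-1) 1) ∧ (∀ ω ∈ Set.Ioo (-1 : ℝ) 1, 0 < g ω) ∧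
      τ.restrict (Set.Ioo (-1) 1) =
        (volume.restrict (Set.Ioo (-1) 1)).withDensity (fun ω => ENNReal.ofReal (g ω)) := by
  have hint : ∀ f : ℝ[X], Integrable (fun ω => f.eval ω) τ := integrable_eval_unit hsupp
  -- the Jacobi coefficients `A n = a_{n+1} = k_n / k_{n+1}`
  let A : ℕ → ℝ := fun n => (p n).leadingCoeff / (p (n + 1)).leadingCoeff
  have hAdef : ∀ n, A n = (p n).leadingCoeff / (p (n + 1)).leadingCoeff := fun n => rfl
  have hApos : ∀ n, 0 < A n := fun n => div_pos (hlc n) (hlc (n + 1))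
  have hAlim : Tendsto A atTop (𝓝 (1 / 2)) := hlim
  have hAbv : Summable (fun n => |A (n + 1) - A n|) := hbv
  -- R: the recurrence
  obtain ⟨hrec0, hrec⟩ := stub_mnRecurrence τ p A hint heven hdeg hlc horth hAdef
  -- T: the Turán limit
  have hp0deg : (p 0).natDegree = 0 := hdeg 0
  have hp0 : p 0 ≠ 0 := fun h => by
    have := hlc 0; rw [h, leadingCoeff_zero] at this; exact lt_irrefl _ this
  obtain ⟨S, hScont, hSpos, hSunif⟩ := stub_mnTuran A p hApos hAlim hAbv hp0deg hp0 hrec0 hrec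
  -- the Turán forms as test densities
  set F : ℕ → ℝ → ℝ := fun n x => ((p (n + 1)).eval x) ^ 2
    - x / A n * (p (n + 1)).eval x * (p n).eval x + ((p n).eval x) ^ 2 with hF
  have hFcont : ∀ n, Continuous (F n) := fun n => by
    simp only [hF]; fun_prop
  -- the L¹ bound
  obtain ⟨M, hM⟩ := (hAlim.inv₀ (by norm_num : (1 / 2 : ℝ) ≠ 0)).bddAbove_range
  have hL1 : ∃ C : ℝ, ∀ n, ∫ ω, |F n ω| ∂τ ≤ C := by
    refine ⟨2 + M, fun n => ?_⟩
    have h1 := integral_abs_turan_le hsupp p horth A hApos n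
    have h2 : (A n)⁻¹ ≤ M := hM ⟨n, rfl⟩
    simp only [hF]
    linarith
  -- the semicircle weight
  set w : ℝ → ℝ := fun x => 2 / Real.pi * Real.sqrt (1 - x ^ 2) with hw
  have hwcont : Continuous w := by simp only [hw]; fun_prop
  -- L + M: the Chebyshev test limits
  have hcheb : ∀ m : ℕ, Tendsto (fun n : ℕ => ∫ ω, (Polynomial.Chebyshev.T ℝ m).eval ω * F n ω ∂τ)
      atTop (𝓝 (∫ x in (-1 : ℝ)..1, (Polynomial.Chebyshev.T ℝ m).eval x * w x)) := by
    intro m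
    have hL := stub_mnLocality τ p A hint horth hApos hAlim hrec0 hrec m
    have hMm := stub_mnChebyshevMoments m
    have hval : ∫ x in (-1 : ℝ)..1, (Polynomial.Chebyshev.T ℝ m).eval x * w x =
        (if m = 0 then 1 else if m = 2 then -(1 / 2) else 0) := by
      have e : (fun x => (Polynomial.Chebyshev.T ℝ m).eval x * w x) =
          fun x => 2 / Real.pi * ((Polynomial.Chebyshev.T ℝ m).eval x * Real.sqrt (1 - x ^ 2)) := by
        funext x; simp only [hw]; ring
      rw [e, intervalIntegral.integral_const_mul, hMm]
      field_simp
    rw [hval]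
    simpa only [hF] using hL
  -- W0: compactly supported test functions
  have hW0 := stub_mnTestFunctions τ inferInstance hsupp F S w hFcont hwcont hL1 hSunif hcheb
  -- the density
  set g : ℝ → ℝ := fun x => w x / S x with hg
  have hwpos : ∀ x ∈ Set.Ioo (-1 : ℝ) 1, 0 < w x := fun x hx => by
    simp only [hw]
    have : 0 < 1 - x ^ 2 := by nlinarith [hx.1, hx.2]
    positivity
  have hgcont : ContinuousOn g (Set.Ioo (-1) 1) :=
    hwcont.continuousOn.div hScont fun x hx => (hSpos x hx).ne'
  have hgpos : ∀ x ∈ Set.Ioo (-1 : ℝ) 1, 0 < g x := fun x hx => div_pos (hwpos x hx) (hSpos x hx)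
  -- W: identification, after dividing the test functions by `S`
  have hWhyp : ∀ f : ℝ → ℝ, Continuous f → HasCompactSupport f → tsupport f ⊆ Set.Ioo (-1) 1 →
      ∫ ω, f ω ∂τ = ∫ x in Set.Ioo (-1 : ℝ) 1, f x * g x := by
    intro f hfc hfs hft
    -- `h = f / S` is again an admissible test function
    set h : ℝ → ℝ := fun x => f x / S x with hh
    have hzero : ∀ x, x ∉ Set.Ioo (-1 : ℝ) 1 → f x = 0 := fun x hx =>
      image_eq_zero_of_notMem_tsupport fun h' => hx (hft h')
    have hhc : Continuous h := by
      rw [continuous_iff_continuousAt]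
      intro x
      by_cases hx : x ∈ Set.Ioo (-1 : ℝ) 1
      · exact (hfc.continuousAt).div (hScont.continuousAt (Ioo_mem_nhds hx.1 hx.2)) (hSpos x hx).ne'
      · -- off `tsupport f`, `h` vanishes identically near `x`
        have hx' : x ∉ tsupport f := fun h' => hx (hft h')
        have hnhds : (tsupport f)ᶜ ∈ 𝓝 x := (isClosed_tsupport f).isOpen_compl.mem_nhds hx'
        have hev : h =ᶠ[𝓝 x] fun _ => 0 := by
          filter_upwards [hnhds] with y hy
          simp only [hh, image_eq_zero_of_notMem_tsupport hy, zero_div]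
        exact (continuousAt_const.congr hev.symm)
    have hhs : HasCompactSupport h := by
      refine hfs.mono fun x hx => ?_
      simp only [Function.mem_support, ne_eq, hh] at hx ⊢
      intro hf0; exact hx (by rw [hf0, zero_div])
    have hht : tsupport h ⊆ Set.Ioo (-1) 1 := by
      refine Subset.trans (closure_mono fun x hx => ?_) hft
      simp only [Function.mem_support, ne_eq, hh] at hx ⊢
      intro hf0; exact hx (by rw [hf0, zero_div])
    have key := hW0 h hhc hhs hht
    -- left side: `h S = f` everywhere
    have hlhs : (fun ω => h ω * S ω) = f := by
      funext x
      by_cases hx : x ∈ Set.Ioo (-1 : ℝ) 1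
      · simp only [hh]; exact div_mul_cancel₀ _ (hSpos x hx).ne'
      · simp only [hh, hzero x hx, zero_div, zero_mul]
    -- right side: `h w = f g`
    have hrhs : (fun x => h x * w x) = fun x => f x * g x := by
      funext x; simp only [hh, hg]; ring
    rw [hlhs, hrhs, intervalIntegral.integral_of_le (by norm_num : (-1 : ℝ) ≤ 1),
      integral_Ioc_eq_integral_Ioo] at key
    exact key
  exact ⟨g, hgcont, hgpos, stub_mnIdentification τ inferInstance g hgcont hgpos hWhyp⟩

/-! ## S3 — the engine on a general band `[-W, W]` (affine transport `x = ω / W`) -/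

/-- **S3 `stub_mateNevaiBoundedVariation` — Máté–Nevai bounded-variation theorem (even measures, band
`[-W, W]`)**, PROVED from `mateNevai_unitBand` by the rescaling `x = ω / W` (as in the tree's
`Literature.Analysis.Approximation.mateNevaiBoundedVariationEven_of`): the rescaled measure
`τ ∘ (ω ↦ ω/W)⁻¹` is finite, even, carried by `[-1, 1]`, with orthonormal polynomials `p_n(W x)`
(leading coefficients `k_n W^n`, so `a_n ↦ a_n / W → 1/2` with the rescaled variation); the density
`g'` on `(-1, 1)` transports back to `g(ω) = W⁻¹ g'(ω / W)`
(`restrict_Ioo_eq_withDensity_of_map_inv_mul`). This statement is `rfl`-identical to the named fact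
`Literature.Analysis.Approximation.MateNevaiBoundedVariationEven`. [cite: VanAssche1987, Thm 2.27 (case b_n = 0)] -/
theorem stub_mateNevaiBoundedVariation :
    ∀ (τ : Measure ℝ) (W : ℝ), IsFiniteMeasure τ → 0 < W →
      τ.map (fun ω : ℝ => -ω) = τ → τ (Set.Icc (-W) W)ᶜ = 0 →
      ∀ p : ℕ → Polynomial ℝ,
        (∀ n, (p n).natDegree = n) → (∀ n, 0 < (p n).leadingCoeff) →
        (∀ m n, ∫ ω, (p m).eval ω * (p n).eval ω ∂τ = if m = n then 1 else 0) →
        Tendsto (fun n => (p n).leadingCoeff / (p (n + 1)).leadingCoeff) atTop (𝓝 (W / 2)) →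
        Summable (fun n => |(p (n + 1)).leadingCoeff / (p (n + 2)).leadingCoeff -
          (p n).leadingCoeff / (p (n + 1)).leadingCoeff|) →
        ∃ g : ℝ → ℝ, ContinuousOn g (Set.Ioo (-W) W) ∧ (∀ ω ∈ Set.Ioo (-W) W, 0 < g ω) ∧
          τ.restrict (Set.Ioo (-W) W) =
            (volume.restrict (Set.Ioo (-W) W)).withDensity (fun ω => ENNReal.ofReal (g ω)) := by
  intro τ W hfin hW heven hsupp p hpdeg hplc hporth hlim hbv
  have hW0 : W ≠ 0 := hW.ne'
  have hme : Measurable fun ω : ℝ => W⁻¹ * ω := measurable_const_mul _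
  have hφe : MeasurableEmbedding (fun ω : ℝ => W⁻¹ * ω) :=
    measurableEmbedding_mulLeft₀ (inv_ne_zero hW0)
  -- rescaling to the band `[-1, 1]`: `τ' = τ ∘ (ω ↦ W⁻¹ ω)⁻¹`, `p' n = p n (W x)`
  set τ' : Measure ℝ := τ.map (fun ω : ℝ => W⁻¹ * ω) with hτ'
  set p' : ℕ → ℝ[X] := fun n => (p n).comp (C W * X) with hp'
  haveI hfin' : IsFiniteMeasure τ' := Measure.isFiniteMeasure_map τ _
  have hWW : ∀ ω : ℝ, W * (W⁻¹ * ω) = ω := fun ω => mul_inv_cancel_left₀ hW0 ω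
  have hint' : ∀ F : ℝ → ℝ, ∫ x, F x ∂τ' = ∫ ω, F (W⁻¹ * ω) ∂τ := fun F => hφe.integral_map F
  -- `τ'` is even
  have heven' : τ'.map (fun x : ℝ => -x) = τ' := by
    rw [hτ', Measure.map_map measurable_neg hme]
    have hcomp : ((fun x : ℝ => -x) ∘ fun ω : ℝ => W⁻¹ * ω) =
        (fun ω : ℝ => W⁻¹ * ω) ∘ fun ω : ℝ => -ω := by
      funext ω; simp only [Function.comp_apply]; ring
    rw [hcomp, ← Measure.map_map hme measurable_neg, heven]
  -- `τ'` is carried by `[-1, 1]`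
  have hsupp' : τ' (Set.Icc (-1 : ℝ) 1)ᶜ = 0 := by
    rw [hτ', Measure.map_apply hme measurableSet_Icc.compl]
    refine measure_mono_null (fun ω hω => ?_) hsupp
    simp only [Set.mem_preimage, Set.mem_compl_iff, Set.mem_Icc, not_and_or, not_le] at hω ⊢
    rcases hω with h | h
    · left
      have : W⁻¹ * ω < W⁻¹ * (-W) := by rw [mul_neg, inv_mul_cancel₀ hW0]; exact h
      nlinarith [inv_pos.2 hW, mul_pos (inv_pos.2 hW) hW]
    · right
      have : W⁻¹ * W < W⁻¹ * ω := by rw [inv_mul_cancel₀ hW0]; exact h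
      nlinarith [inv_pos.2 hW, mul_pos (inv_pos.2 hW) hW]
  have hp'eval : ∀ n x, (p' n).eval x = (p n).eval (W * x) := fun n x => by
    simp [hp', eval_comp]
  have h1 : (C W * X).natDegree = 1 := natDegree_C_mul_X _ hW0
  have hp'deg : ∀ n, (p' n).natDegree = n := fun n => by
    simp only [hp']; rw [natDegree_comp, hpdeg, h1, mul_one]
  have hp'lc : ∀ n, (p' n).leadingCoeff = (p n).leadingCoeff * W ^ n := fun n => by
    simp only [hp']
    rw [leadingCoeff_comp (by rw [h1]; exact one_ne_zero), leadingCoeff_C_mul_X, hpdeg]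
  have hp'lcpos : ∀ n, 0 < (p' n).leadingCoeff := fun n => by
    rw [hp'lc]; exact mul_pos (hplc n) (pow_pos hW n)
  have hp'orth : ∀ m n, ∫ x, (p' m).eval x * (p' n).eval x ∂τ' = if m = n then 1 else 0 := by
    intro m n
    rw [hint' (fun x => (p' m).eval x * (p' n).eval x)]
    simpa only [hp'eval, hWW] using hporth m n
  have ha' : ∀ n, (p' n).leadingCoeff / (p' (n + 1)).leadingCoeff =
      (p n).leadingCoeff / (p (n + 1)).leadingCoeff * W⁻¹ := fun n => by
    have hk : (p (n + 1)).leadingCoeff ≠ 0 := (hplc _).ne'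
    have hWn : W ^ n ≠ 0 := pow_ne_zero _ hW0
    rw [hp'lc, hp'lc, pow_succ]
    field_simp
  have hlim' : Tendsto (fun n => (p' n).leadingCoeff / (p' (n + 1)).leadingCoeff) atTop
      (𝓝 (1 / 2)) := by
    rw [(funext ha' : (fun n => (p' n).leadingCoeff / (p' (n + 1)).leadingCoeff) = _),
      show (1 / 2 : ℝ) = W / 2 * W⁻¹ by field_simp]
    exact hlim.mul_const _
  have hbv' : Summable (fun n => |(p' (n + 1)).leadingCoeff / (p' (n + 2)).leadingCoeff -
      (p' n).leadingCoeff / (p' (n + 1)).leadingCoeff|) := by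
    have e : ∀ n, |(p' (n + 1)).leadingCoeff / (p' (n + 2)).leadingCoeff -
        (p' n).leadingCoeff / (p' (n + 1)).leadingCoeff| =
        |(p (n + 1)).leadingCoeff / (p (n + 2)).leadingCoeff -
          (p n).leadingCoeff / (p (n + 1)).leadingCoeff| * W⁻¹ := fun n => by
      rw [(ha' (n + 1) : (p' (n + 1)).leadingCoeff / (p' (n + 2)).leadingCoeff = _), ha' n,
        ← sub_mul, abs_mul, abs_of_pos (inv_pos.2 hW)]
    simp_rw [e]; exact hbv.mul_right _
  -- the unit-band theorem, transported back to `(-W, W)`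
  obtain ⟨g', hg'c, hg'pos, hτ'g⟩ :=
    mateNevai_unitBand τ' heven' hsupp' p' hp'deg hp'lcpos hp'orth hlim' hbv'
  exact ⟨fun ω => W⁻¹ * g' (W⁻¹ * ω),
    continuousOn_const.mul (hg'c.comp (continuous_const_mul W⁻¹).continuousOn
      (Literature.Analysis.Approximation.inv_mul_mapsTo_Ioo hW)),
    fun ω hω => mul_pos (inv_pos.2 hW)
      (hg'pos _ (Literature.Analysis.Approximation.inv_mul_mapsTo_Ioo hW hω)),
    Literature.Analysis.Approximation.restrict_Ioo_eq_withDensity_of_map_inv_mul τ W hW g' hτ'g⟩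

/-- **Discharge of the Literature named fact** `MateNevaiBoundedVariationEven` (Máté–Nevai 1983 /
Van Assche LNM 1265 Thm 2.27, case `b_n = 0`): it is, literally, stub S3. -/
theorem mateNevaiBoundedVariationEven_holds :
    Literature.Analysis.Approximation.MateNevaiBoundedVariationEven :=
  stub_mateNevaiBoundedVariation

end Summit.AtomisticToContinuum.FouriersLaw.Theorems.GreenKuboContinuation.BandLimitedKrylov

end
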